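import Summits.ValiantsHypothesis.ValiantsHypothesis.Theorems.GrenetZeonDualUnipotentThreeHalvesHeavyTopKrylovSeed
import Summits.ValiantsHypothesis.ValiantsHypothesis.Theorems.GrenetZeonDualUnipotentThreeHalvesWordFlagPencil

/-!
# Sketch — val-idea-26 g3 (crux `stmt-ValiantsHypothesis-24318`, R2 `HeavyTopLaw`): NIL-CORES

Card `nil-core` (Cruxes/DualUnipotentThreeHalves/Ideas/nil-core.md).  A NIL-CORE of a space of matrices `W` is a subspace
`T ≤ W` all of whose `ℓ`-fold products vanish (`IsNilCore T ℓ`; equivalently the associative algebra generated by `T` is nilpotent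
of class `≤ ℓ`, equivalently — Levitzki/Radjavi — every WORD in elements of `T` is traceless, not only the symmetrised words, which are
traceless on all of `W` for free).  Its descending orbit chain `ℂ^m = F₀ ⊇ F₁ = T•F₀ ⊇ … ⊇ F_ℓ = 0` (`coreFlag`) is a WEIGHT FLAG in
the sense of `WeightThin` with `p = ℓ` levels, climb `c = 1` on `K = N_lin⁻¹(T)` and FREE drop `r = ℓ − 1` (no drop control at all), so

  `((ℓ−1)·n/ℓ + 1)·n < dim K  ⟹  WeightThin n m N`      (★ `weightThin_of_nilCore`, proved below, 0 sorry)

i.e. a nil-core of class `ℓ` and top-codimension `tc` certifies R2 as soon as `ℓ·(tc + n) < n²` (up to rounding).  The research residue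
is the law `NilCoreLaw` (typed below, NOT asserted): in the regime `C₀m² < n³` every irreducible affine nilpotent pencil has such a core.
[val-idea-26 g3; MOR 1991 (paper:doi-10-1016-0024-3795-91-90335-t) Lemma 2 + p.14; de Seguins Pazzis arXiv:1804.07938 Lemma 2.1;
Radjavi–Rosenthal, Simultaneous Triangularization §1.4, §2.1]
-/

noncomputable section

namespace Summit.ValiantsHypothesis.ValiantsHypothesis.Cruxes.DualUnipotentThreeHalves.NilCore

open MvPolynomial Matrix
open Summit.ValiantsHypothesis.ValiantsHypothesis.Cruxes.TwoDimCoefficients.DimTwoCases (AffMat IsAffine)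
open Summit.ValiantsHypothesis.ValiantsHypothesis.Theorems.GrenetZeon.RadicalSplit
open Summit.ValiantsHypothesis.ValiantsHypothesis.Theorems.GrenetZeon.KrylovSeed
open Summit.ValiantsHypothesis.ValiantsHypothesis.Theorems.GrenetZeon.RadicalCoarsening
  (exists_adapted_basis conj_entry_eq_repr toMatrix'_equivFun_mul_symm toMatrix'_symm_mul_equivFun)

variable {m : ℕ}

/-- `T` is a NIL-CORE of class `≤ ℓ`: every product of `ℓ` members of `T` vanishes (so the associative algebra generated by
`T` is nilpotent of class `≤ ℓ`). [val-idea-26 g3] -/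
def IsNilCore (T : Submodule ℂ (Matrix (Fin m) (Fin m) ℂ)) (ℓ : ℕ) : Prop :=
  ∀ f : Fin ℓ → Matrix (Fin m) (Fin m) ℂ, (∀ i, f i ∈ T) → (List.ofFn f).prod = 0

/-- The descending ORBIT CHAIN of `T`: `F_t = span {A₁ ⋯ A_t v : Aᵢ ∈ T, v ∈ ℂ^m}` (`F₀ = ℂ^m`). [val-idea-26 g3] -/
def coreFlag (T : Submodule ℂ (Matrix (Fin m) (Fin m) ℂ)) (t : ℕ) : Submodule ℂ (Fin m → ℂ) :=
  Submodule.span ℂ {y | ∃ f : Fin t → Matrix (Fin m) (Fin m) ℂ, (∀ i, f i ∈ T) ∧ ∃ v, y = (List.ofFn f).prod *ᵥ v}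

theorem coreFlag_zero (T : Submodule ℂ (Matrix (Fin m) (Fin m) ℂ)) : coreFlag T 0 = ⊤ := by
  refine eq_top_iff.mpr fun y _ => Submodule.subset_span ?_
  exact ⟨Fin.elim0, fun i => i.elim0, y, by simp⟩

theorem coreFlag_antitone (T : Submodule ℂ (Matrix (Fin m) (Fin m) ℂ)) : Antitone (coreFlag T) := by
  intro t s hts
  obtain ⟨k, rfl⟩ := Nat.exists_eq_add_of_le hts
  refine Submodule.span_le.mpr ?_
  rintro y ⟨f, hf, v, rfl⟩
  refine Submodule.subset_span ⟨fun i => f (Fin.castLE (Nat.le_add_right t k) i), fun i => hf _,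
    (List.ofFn fun j => f (Fin.natAdd t j)).prod *ᵥ v, ?_⟩
  rw [List.ofFn_add, List.prod_append, Matrix.mulVec_mulVec]

theorem mulVec_mem_coreFlag_succ (T : Submodule ℂ (Matrix (Fin m) (Fin m) ℂ)) {A : Matrix (Fin m) (Fin m) ℂ}
    (hA : A ∈ T) {t : ℕ} {y : Fin m → ℂ} (hy : y ∈ coreFlag T t) : A *ᵥ y ∈ coreFlag T (t + 1) := by
  have : coreFlag T t ≤ (coreFlag T (t + 1)).comap (Matrix.toLin' A) := by
    refine Submodule.span_le.mpr ?_
    rintro y ⟨f, hf, v, rfl⟩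
    refine Submodule.subset_span ⟨Fin.cons A f, fun i => ?_, v, ?_⟩
    · refine Fin.cases ?_ (fun j => ?_) i
      · simpa using hA
      · simpa using hf j
    · simp [Matrix.toLin'_apply, List.ofFn_succ, Matrix.mulVec_mulVec]
  exact this hy

theorem coreFlag_eq_bot_of_isNilCore (T : Submodule ℂ (Matrix (Fin m) (Fin m) ℂ)) {ℓ : ℕ} (hT : IsNilCore T ℓ) :
    coreFlag T ℓ = ⊥ := by
  refine (Submodule.span_eq_bot).mpr ?_
  rintro y ⟨f, hf, v, rfl⟩
  rw [hT f hf, Matrix.zero_mulVec]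

/-- ★ **NIL-CORES ARE WEIGHT CERTIFICATES** (first lemma of the card, PROVED).  If the tops `N_lin(v)`, `v ∈ K`, of an affine pencil lie
in a nil-core `T` of class `≤ ℓ` (`ℓ ≥ 1`) and `((ℓ−1)·n/ℓ + 1)·n < dim K`, the pencil is `WeightThin n m N`: levels = the orbit chain of
`T` (`p = ℓ`), climb `c = 1`, drop `r = ℓ − 1` (vacuous — no hypothesis on `N(x)` at all). [val-idea-26 g3] -/
theorem weightThin_of_nilCore {n : ℕ} (N : AffMat n m)
    (T : Submodule ℂ (Matrix (Fin m) (Fin m) ℂ)) (ℓ : ℕ) (hℓ : 1 ≤ ℓ) (hT : IsNilCore T ℓ)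
    (K : Submodule ℂ (Fin n × Fin n → ℂ)) (hK : ∀ v ∈ K, linPart N v ∈ T)
    (hdim : ((ℓ - 1) * n / ℓ + 1) * n < Module.finrank ℂ K) :
    WeightThin n m N := by
  classical
  have hanti := coreFlag_antitone T
  obtain ⟨b, lvl, hbmem, hlvl, key, -⟩ :=
    exists_adapted_basis (coreFlag T) hanti (coreFlag_zero T) (coreFlag_eq_bot_of_isNilCore T hT)
  let Pm : Matrix (Fin m) (Fin m) ℂ := LinearMap.toMatrix' (b.equivFun : (Fin m → ℂ) →ₗ[ℂ] (Fin m → ℂ))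
  let Qm : Matrix (Fin m) (Fin m) ℂ := LinearMap.toMatrix' (b.equivFun.symm : (Fin m → ℂ) →ₗ[ℂ] (Fin m → ℂ))
  let P : (Matrix (Fin m) (Fin m) ℂ)ˣ := ⟨Pm, Qm, toMatrix'_equivFun_mul_symm b, toMatrix'_symm_mul_equivFun b⟩
  have hentry : ∀ (A : Matrix (Fin m) (Fin m) ℂ) (i j : Fin m), (Pm * A * Qm) i j = b.repr (A *ᵥ b j) i :=
    fun A i j => conj_entry_eq_repr b A i j
  refine ⟨P, lvl, ℓ, ℓ - 1, 1, K, le_rfl, hlvl, ?_, ?_, ?_⟩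
  · -- drop `r = ℓ − 1`: vacuous, all levels lie in `[0, ℓ)`
    intro i j hij
    exact absurd hij (by have := hlvl j; omega)
  · -- climb `c = 1`: a top in `T` maps `F_t` into `F_{t+1}`
    intro v hv i j hij
    show (Pm * linPart N v * Qm) i j = 0
    rw [hentry]
    by_contra hne
    have hy : linPart N v *ᵥ b j ∈ coreFlag T (lvl j + 1) := mulVec_mem_coreFlag_succ T (hK v hv) (hbmem j)
    have := key (lvl j + 1) _ hy i hne
    omega
  · -- budget: `(ℓ−1 + (ℓ−1)(n−1))/(1+(ℓ−1)) = (ℓ−1)n/ℓ` for `n ≥ 1`; both sides vanish for `n = 0`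
    rcases Nat.eq_zero_or_pos n with rfl | hn
    · simpa using hdim
    · obtain ⟨k, rfl⟩ := Nat.exists_eq_add_of_le hn
      have h1 : ℓ - 1 + (ℓ - 1) * (1 + k - 1) = (ℓ - 1) * (1 + k) := by
        rw [Nat.add_sub_cancel_left]; ring
      have h2 : 1 + (ℓ - 1) = ℓ := Nat.add_sub_of_le hℓ
      rw [h1, h2]
      exact hdim

/-- **`NilCoreLaw`** — the card's research residue (a CANDIDATE law, NOT asserted): in the regime `C₀·m² < n³` every IRREDUCIBLE affine
nilpotent pencil (`𝒜(N) = M_m`; irreducible pencils are heavy-top, radical_split.md D1) has a nil-core `T ∋ N_lin(K)` of class `ℓ` with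
`((ℓ−1)n/ℓ + 1)·n < dim K` — informally `ℓ·(tc + n) < n²`, `tc = codim N_lin⁻¹(T)`.  With ★ it gives `WeightThin` on the irreducible
locus of S1b (`FatBlockWeightLaw`, Lines/krylov_seed.lean); the reducible fat-block case is glued by the line's S1a/S1c. [val-idea-26 g3] -/
def NilCoreLaw : Prop :=
  ∃ C₀ n₀ : ℕ, ∀ n ≥ n₀, ∀ m : ℕ, C₀ * m ^ 2 < n ^ 3 → ∀ N : AffMat n m, IsAffine N → N ^ m = 0 → pencilAlg N = ⊤ →
    ∃ (T : Submodule ℂ (Matrix (Fin m) (Fin m) ℂ)) (ℓ : ℕ) (K : Submodule ℂ (Fin n × Fin n → ℂ)),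
      1 ≤ ℓ ∧ IsNilCore T ℓ ∧ (∀ v ∈ K, linPart N v ∈ T) ∧ ((ℓ - 1) * n / ℓ + 1) * n < Module.finrank ℂ K

/-- The law closes the irreducible locus (one line from ★). [val-idea-26 g3] -/
theorem weightThin_of_nilCoreLaw (h : NilCoreLaw) :
    ∃ C₀ n₀ : ℕ, ∀ n ≥ n₀, ∀ m : ℕ, C₀ * m ^ 2 < n ^ 3 → ∀ N : AffMat n m, IsAffine N → N ^ m = 0 → pencilAlg N = ⊤ →
      WeightThin n m N := by
  obtain ⟨C₀, n₀, h⟩ := h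
  refine ⟨C₀, n₀, fun n hn m hm N hN hnil hirr => ?_⟩
  obtain ⟨T, ℓ, K, hℓ, hT, hK, hdim⟩ := h n hn m hm N hN hnil hirr
  exact weightThin_of_nilCore N T ℓ hℓ hT K hK hdim


/-! ## §3 The INDEX-CORE certificate (weaker hypothesis, R2's own currency `FlagCheap`)

For R2's target `FlagCheap` (line-DEPENDENT flags) the joint nilpotency of the core is not needed: it suffices that every
element of `T` has NILINDEX `≤ a`.  A letter `Q` with `Q ^ a = 0` makes every word with a `Q`-run of length `≥ a` vanish, so a
nonzero word has `#Q ≤ (a-1)·(#P+1)`: word-tame profile `(r, c, Θ) = (a-1, 1, a-1)`, budget `⌊(a-1)n/a⌋` — the general-`a`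
version of the tree's ✓ `wordTame_of_sq_eq_zero` (`a = 2`, budget `⌊n/2⌋`) and the CONVERSE direction of ✓ `pow_eq_zero_of_wordTame`
(budget `k` forces `Q^{k+1} = 0`).  With ✓ `flagCheap_iff_wordCheap` this gives `flagCheap_of_indexCore`: same numerology
`a·(tc + n) < n²` as the nil-core certificate, hypothesis per element instead of per word. -/

/-- Run-length count: if `Q ^ a = 0` then a nonzero word has `#Q + j ≤ (a-1)·(#P + 1)` whenever it stays nonzero after `j`
more `Q`'s on the left (the invariant that makes the structural induction go through; use `j = 0`). -/
theorem count_true_add_le_of_pow_eq_zero {a : ℕ} (P Q : Matrix (Fin m) (Fin m) ℂ) (hQ : Q ^ a = 0) :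
    ∀ (w : List Bool) (j : ℕ), Q ^ j * word P Q w ≠ 0 → w.count true + j ≤ (a - 1) * (w.count false + 1)
  | [], j, h => by
    have hj : j < a := by
      by_contra hja
      exact h (by rw [pow_eq_zero_of_le (not_lt.mp hja) hQ, zero_mul])
    simp only [List.count_nil, zero_add, mul_one]
    omega
  | true :: w, j, h => by
    have h' : Q ^ (j + 1) * word P Q w ≠ 0 := by
      rwa [word_cons, if_pos rfl, ← Matrix.mul_assoc, ← pow_succ] at h
    have ih := count_true_add_le_of_pow_eq_zero P Q hQ w (j + 1) h'
    simp only [List.count_cons_self]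
    have hf : (true :: w).count false = w.count false := by simp
    rw [hf]; omega
  | false :: w, j, h => by
    have hj : j < a := by
      by_contra hja
      exact h (by rw [pow_eq_zero_of_le (not_lt.mp hja) hQ, zero_mul])
    have hcons : word P Q (false :: w) = P * word P Q w := by simp [word_cons]
    have h' : Q ^ 0 * word P Q w ≠ 0 := by
      intro hw
      apply h
      rw [pow_zero, one_mul] at hw
      rw [hcons, hw, Matrix.mul_zero, Matrix.mul_zero]
    have ih := count_true_add_le_of_pow_eq_zero P Q hQ w 0 h'
    simp only [List.count_cons_self]
    have ht : (false :: w).count true = w.count true := by simp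
    rw [ht]
    have : (a - 1) * (w.count false + 1 + 1) = (a - 1) * (w.count false + 1) + (a - 1) := by ring
    rw [this]; omega

/-- **Index ⇒ word-tame**: `Q ^ a = 0` (`1 ≤ a`) makes `(P, Q)` word-tame with budget `⌊(a-1)n/a⌋` (profile
`(r, c, Θ) = (a-1, 1, a-1)`).  General-`a` version of ✓ `wordTame_of_sq_eq_zero`. -/
theorem wordTame_of_pow_eq_zero {n k a : ℕ} (ha : 1 ≤ a) (hk : (a - 1) * n / a ≤ k) (P Q : Matrix (Fin m) (Fin m) ℂ)
    (hQ : Q ^ a = 0) : WordTame n k P Q := by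
  refine ⟨a - 1, 1, a - 1, le_rfl, ?_, fun w hw => ?_⟩
  · have h1 : 1 + (a - 1) = a := by omega
    rw [h1]
    rcases Nat.eq_zero_or_pos n with rfl | hn
    · rw [Nat.div_eq_of_lt (by omega)]; exact Nat.zero_le _
    · have h2 : a - 1 + (a - 1) * (n - 1) = (a - 1) * n := by
        calc a - 1 + (a - 1) * (n - 1) = (a - 1) * (n - 1 + 1) := by ring
          _ = (a - 1) * n := by rw [Nat.sub_add_cancel hn]
      rw [h2]; exact hk
  · have := count_true_add_le_of_pow_eq_zero P Q hQ w 0 (by rwa [pow_zero, one_mul])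
    simp only [add_zero, one_mul] at this ⊢
    calc w.count true ≤ (a - 1) * (w.count false + 1) := this
      _ = a - 1 + (a - 1) * w.count false := by ring

/-- **INDEX-CORE CERTIFICATE.**  A subspace `T` of matrices of nilindex `≤ a`, a direction space `K` whose tops lie in `T`,
and the budget `(⌊(a-1)n/a⌋ + 1)·n < dim K` (informally `a·(codim T + n) < n²`) make the affine pencil flag-cheap. -/
theorem flagCheap_of_indexCore {n : ℕ} (N : AffMat n m) (hN : IsAffine N) (T : Submodule ℂ (Matrix (Fin m) (Fin m) ℂ))
    (a : ℕ) (ha : 1 ≤ a) (hT : ∀ Q ∈ T, Q ^ a = 0) (K : Submodule ℂ (Fin n × Fin n → ℂ))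
    (hK : ∀ v ∈ K, linPart N v ∈ T) (hdim : ((a - 1) * n / a + 1) * n < Module.finrank ℂ K) : FlagCheap n m N :=
  (flagCheap_iff_wordCheap N hN).2 ⟨K, (a - 1) * n / a, hdim, fun _ v hv => wordTame_of_pow_eq_zero ha le_rfl _ _ (hT _ (hK v hv))⟩

/-- A nil-core of class `ℓ` is in particular an index-core of index `ℓ`. -/
theorem pow_eq_zero_of_isNilCore {T : Submodule ℂ (Matrix (Fin m) (Fin m) ℂ)} {ℓ : ℕ} (hT : IsNilCore T ℓ)
    {Q : Matrix (Fin m) (Fin m) ℂ} (hQ : Q ∈ T) : Q ^ ℓ = 0 := by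
  have := hT (fun _ => Q) (fun _ => hQ)
  rwa [List.ofFn_const, List.prod_replicate] at this

/-- **INDEX-CORE LAW** (research stub, weaker than `NilCoreLaw`; NOT asserted): in the regime every heavy-top-type affine
nilpotent pencil has a top subspace of uniformly small nilindex and small codimension.  Stated on ALL nilpotent affine
pencils of the regime it is exactly a sufficient condition for `FlagCostLaw`; the interesting restriction is again the
irreducible locus. -/
def IndexCoreLaw : Prop :=
  ∃ C₀ n₀ : ℕ, ∀ n ≥ n₀, ∀ m : ℕ, C₀ * m ^ 2 < n ^ 3 → ∀ N : AffMat n m, IsAffine N → N ^ m = 0 → pencilAlg N = ⊤ →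
    ∃ (T : Submodule ℂ (Matrix (Fin m) (Fin m) ℂ)) (a : ℕ) (K : Submodule ℂ (Fin n × Fin n → ℂ)),
      1 ≤ a ∧ (∀ Q ∈ T, Q ^ a = 0) ∧ (∀ v ∈ K, linPart N v ∈ T) ∧ ((a - 1) * n / a + 1) * n < Module.finrank ℂ K

theorem indexCoreLaw_of_nilCoreLaw (h : NilCoreLaw) : IndexCoreLaw := by
  obtain ⟨C₀, n₀, h⟩ := h
  refine ⟨C₀, n₀, fun n hn m' hm N hN hnil hirr => ?_⟩
  obtain ⟨T, ℓ, K, hℓ, hT, hK, hdim⟩ := h n hn m' hm N hN hnil hirr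
  exact ⟨T, ℓ, K, hℓ, fun Q hQ => pow_eq_zero_of_isNilCore hT hQ, hK, hdim⟩

theorem flagCheap_of_indexCoreLaw (h : IndexCoreLaw) :
    ∃ C₀ n₀ : ℕ, ∀ n ≥ n₀, ∀ m : ℕ, C₀ * m ^ 2 < n ^ 3 → ∀ N : AffMat n m, IsAffine N → N ^ m = 0 → pencilAlg N = ⊤ →
      FlagCheap n m N := by
  obtain ⟨C₀, n₀, h⟩ := h
  refine ⟨C₀, n₀, fun n hn m' hm N hN hnil hirr => ?_⟩
  obtain ⟨T, a, K, ha, hT, hK, hdim⟩ := h n hn m' hm N hN hnil hirr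
  exact flagCheap_of_indexCore N hN T a ha hT K hK hdim


/-- **ALL TOPS SHORT ⇒ CHEAP.**  If every top `N_lin(v)` of an affine pencil has nilindex `≤ a` with `a < n`, the pencil is
flag-cheap with `K = ⊤` and budget `⌊(a-1)n/a⌋ ≤ n - 2`.  So R2's residue consists of pencils with a top of nilindex `≥ n`
on every large direction subspace («index-saturated» top spaces). -/
theorem flagCheap_of_top_pow_eq_zero {n : ℕ} (N : AffMat n m) (hN : IsAffine N) (a : ℕ) (ha : 1 ≤ a) (han : a < n)
    (h : ∀ v : Fin n × Fin n → ℂ, (linPart N v) ^ a = 0) : FlagCheap n m N := by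
  refine (flagCheap_iff_wordCheap N hN).2 ⟨⊤, (a - 1) * n / a, ?_, fun _ v _ => wordTame_of_pow_eq_zero ha le_rfl _ _ (h v)⟩
  have hk : (a - 1) * n / a < n - 1 := by
    rw [Nat.div_lt_iff_lt_mul (by omega)]
    have h1 : (a - 1) * n + n = a * n := by
      calc (a - 1) * n + n = (a - 1 + 1) * n := by ring
        _ = a * n := by rw [Nat.sub_add_cancel ha]
    have h2 : (n - 1) * a + a = a * n := by
      calc (n - 1) * a + a = (n - 1 + 1) * a := by ring
        _ = a * n := by rw [Nat.sub_add_cancel (by omega)]; ring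
    omega
  rw [finrank_top, Module.finrank_fintype_fun_eq_card, Fintype.card_prod, Fintype.card_fin]
  calc ((a - 1) * n / a + 1) * n ≤ (n - 1) * n := Nat.mul_le_mul_right _ (by omega)
    _ < n * n := Nat.mul_lt_mul_of_pos_right (by omega) (by omega)

end Summit.ValiantsHypothesis.ValiantsHypothesis.Cruxes.DualUnipotentThreeHalves.NilCore

end
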